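import Summits.Ventures.WeilGRH.TwistedSechDensity
import HarnessLib

/-!
# GRH arm (rh-explicit, venture WeilGRH): the Gram matrix of an ODD REAL character on Yoshida's windows —
  the `sech` block and the entry theorem

Cell `rh-explicit`, WEIL TRACK — GRH ARM (typing seat weil-grh-1).  Sequel of `TwistedSechDensity.lean`
(`twistedWindowForm_eq_of_odd_real`: the twisted window form of an odd real character = the even-real expression
+ `π‖u‖₂² − ∫₀^∞ σ D_t(u)`).  On the trigonometric windows the `σ`-block is the Hermitian form of
`sechIncrCoeff a` (`setIntegral_sech_mul_weilIncrement_sum_smul_chi`: `σ` against Yoshida's increment kernel on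
`(0, 2a]`, plus the tail `∫_{2a}^∞ 2σ = 2π − 4 arctan(e^{a})` on the diagonal), whence the ENTRY THEOREM

  `𝓔^χ_a(Σ c_nχ_n) − M^χ_a‖Σ c_nχ_n‖₂² = Σ_n Σ_m Re(conj c_n c_m)·twistedGramCoeffOdd χ a n m`,
  `twistedGramCoeffOdd χ a n m = twistedGramCoeff χ a n m + π δ_{nm} − sechIncrCoeff a n m`

(`twistedWindowForm_sum_smul_chi_eq_twistedGramCoeffOdd`; characters `3.2 = (−3/·)`, `4.3 = (−4/·)`, `7.6`, `8.3`,
`11.10`, `15.14`, `19.18`, `20.19`, … — the cells where the parity bonus is load-bearing, e.g. 3.2 at `(log 3)/2`,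
EXTREMALS/GRH/Kt-closure-log3half-CERT), and `weilPositivityOnChar_of_twistedGramCoeffOdd_sector_psd` /
`weilPositivityOnChar_of_formatC_certificates_odd` turn per-sector PSD / format-C data into the rung.  The
`σ`-integrals on `(0, 2a]` are regular definite integrals of explicit smooth functions (no closed form; the
certificate layer encloses them — `sech(t/2)` has Taylor radius `π > 2a`).  Two definitions (docstring'd); no named
facts; RH/GRH-free.
-/

set_option autoImplicit false

noncomputable section

open Complex Filter Set MeasureTheory
open scoped Real Topology ComplexConjugate ArithmeticFunction.vonMangoldt

namespace Summit.Ventures.WeilGRH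

open Literature.NumberTheory.LFunctions
open Literature.NumberTheory.LFunctions.Yoshida1992 (modes chi freq gramCoeff polarCoeff incrCoeff)
open Summit.RiemannHypothesis.RiemannHypothesis.Theorems.WeilFormatC

variable {q : ℕ} {a : ℝ}

/-! ## The `sech` block of a trigonometric window -/

/-- **The `sech`-kernel coefficients on Yoshida's basis**: the matrix of `u ↦ ∫₀^∞ D_t(u) dt/(2cosh(t/2))` on the
trigonometric windows — `σ(t) = 1/(2cosh(t/2))` against Yoshida's increment kernel on `(0, 2a]`
(`2 − 2(1 − t/2a)cos ω_n t` on the diagonal, `−(−1)^{n+m}(sin ω_m t − sin ω_n t)/(π(n−m))` off it) plus the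
tail `∫_{2a}^∞ 2σ = 2π − 4 arctan(e^{a})` on the diagonal (`D_t = 2‖u‖²` there).  Smooth, regular definite
integrals (no closed form; `sech(t/2)` has Taylor radius `π > 2a`). -/
def sechIncrCoeff (a : ℝ) (n m : ℤ) : ℝ :=
  if n = m then
    (∫ t in Ioc 0 (2 * a), 1 / (2 * Real.cosh (t / 2)) * (2 - 2 * (1 - t / (2 * a)) * Real.cos (π * n / a * t))) +
      ∫ t in Ioi (2 * a), 1 / (2 * Real.cosh (t / 2)) * 2
  else -(-1 : ℝ) ^ (n + m) / (π * (n - m)) *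
    ((∫ t in Ioc 0 (2 * a), 1 / (2 * Real.cosh (t / 2)) * Real.sin (π * m / a * t)) -
      ∫ t in Ioc 0 (2 * a), 1 / (2 * Real.cosh (t / 2)) * Real.sin (π * n / a * t))

/-- **The Gram coefficient of an ODD REAL character** on Yoshida's basis:
`G^χ_odd(n,m) = twistedGramCoeff χ a n m + π δ_{nm} − sechIncrCoeff a n m` (the even-real matrix plus the
parity bonus `π‖u‖² − ∫₀^∞ σ D_t(u)`).  It IS the matrix of the twisted window form for `conj χ = χ`,
`a_χ = 1` (`twistedWindowForm_sum_smul_chi_eq_twistedGramCoeffOdd`). -/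
def twistedGramCoeffOdd (χ : DirichletCharacter ℂ q) (a : ℝ) (n m : ℤ) : ℝ :=
  twistedGramCoeff χ a n m + (if n = m then π else 0) - sechIncrCoeff a n m

/-- The diagonal tail in closed form: `∫_{2a}^∞ 2σ = 2π − 4 arctan(e^{a})`. -/
theorem integral_sech_density_mul_two_Ioi (a : ℝ) :
    ∫ t in Ioi (2 * a), 1 / (2 * Real.cosh (t / 2)) * 2 = 2 * π - 4 * Real.arctan (Real.exp a) := by
  rw [integral_mul_const, integral_sech_density_Ioi, show 2 * a / 2 = a by ring]
  ring

/-- `σ` times a continuous kernel is integrable on `(0, 2a]`. -/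
private theorem integrableOn_sech_mul_of_continuous {K : ℝ → ℝ} (hK : Continuous K) (a : ℝ) :
    IntegrableOn (fun t ↦ 1 / (2 * Real.cosh (t / 2)) * K t) (Ioc 0 (2 * a)) :=
  ((continuous_sech_density.mul hK).continuousOn.integrableOn_Icc).mono_set Ioc_subset_Icc_self

/-- `σ(t) K_t(n,m)` is integrable on `(0, 2a]` for Yoshida's increment kernel. -/
theorem integrableOn_sech_mul_kernel (a : ℝ) (n m : ℤ) :
    IntegrableOn (fun t ↦ 1 / (2 * Real.cosh (t / 2)) *
      (if n = m then 2 - 2 * (1 - t / (2 * a)) * Real.cos (π * n / a * t)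
        else -(-1 : ℝ) ^ (n + m) * (Real.sin (π * m / a * t) - Real.sin (π * n / a * t)) / (π * (n - m))))
      (Ioc 0 (2 * a)) := by
  by_cases h : n = m
  · simp only [h, if_true]
    exact integrableOn_sech_mul_of_continuous (by fun_prop) a
  · simp only [if_neg h]
    exact integrableOn_sech_mul_of_continuous (by fun_prop) a

/-- **The `sech` block of a trigonometric window as a Hermitian form** (`a > 0`):
`∫₀^∞ σ(t) D_t(Σ c_nχ_n) dt = Σ_n Σ_m Re(conj c_n c_m)·sechIncrCoeff a n m`. -/
theorem setIntegral_sech_mul_weilIncrement_sum_smul_chi (ha : 0 < a) (s : Finset ℤ) (c : ℤ → ℂ) :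
    ∫ t in Ioi 0, 1 / (2 * Real.cosh (t / 2)) * weilIncrement (∑ n ∈ s, c n • chi a n) t =
      ∑ n ∈ s, ∑ m ∈ s, (conj (c n) * c m).re * sechIncrCoeff a n m := by
  have hT : (0 : ℝ) < 2 * a := by positivity
  have hIoc : EqOn (fun t ↦ 1 / (2 * Real.cosh (t / 2)) * weilIncrement (∑ n ∈ s, c n • chi a n) t)
      (fun t ↦ ∑ n ∈ s, ∑ m ∈ s, (conj (c n) * c m).re * (1 / (2 * Real.cosh (t / 2)) *
        (if n = m then 2 - 2 * (1 - t / (2 * a)) * Real.cos (π * n / a * t)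
          else -(-1 : ℝ) ^ (n + m) * (Real.sin (π * m / a * t) - Real.sin (π * n / a * t)) / (π * (n - m)))))
      (Ioc 0 (2 * a)) := by
    intro t ht
    simp only
    rw [weilIncrement_sum_smul_chi ha s c ht.1.le ht.2, Finset.mul_sum]
    refine Finset.sum_congr rfl fun n _ ↦ ?_
    rw [Finset.mul_sum]
    refine Finset.sum_congr rfl fun m _ ↦ ?_
    ring
  have hIoi : EqOn (fun t ↦ 1 / (2 * Real.cosh (t / 2)) * weilIncrement (∑ n ∈ s, c n • chi a n) t)
      (fun t ↦ ∑ n ∈ s, ∑ m ∈ s, (conj (c n) * c m).re * (1 / (2 * Real.cosh (t / 2)) * (if n = m then 2 else 0)))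
      (Ioi (2 * a)) := by
    intro t ht
    simp only
    rw [weilIncrement_sum_smul_chi_of_le ha s c (le_of_lt ht), Finset.mul_sum]
    refine Finset.sum_congr rfl fun n _ ↦ ?_
    rw [Finset.mul_sum]
    refine Finset.sum_congr rfl fun m _ ↦ ?_
    ring
  have iIoc : ∀ n m : ℤ, IntegrableOn (fun t ↦ (conj (c n) * c m).re * (1 / (2 * Real.cosh (t / 2)) *
      (if n = m then 2 - 2 * (1 - t / (2 * a)) * Real.cos (π * n / a * t)
        else -(-1 : ℝ) ^ (n + m) * (Real.sin (π * m / a * t) - Real.sin (π * n / a * t)) / (π * (n - m)))))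
      (Ioc 0 (2 * a)) := fun n m ↦ (integrableOn_sech_mul_kernel a n m).const_mul _
  have iIoi : ∀ n m : ℤ, IntegrableOn (fun t ↦ (conj (c n) * c m).re *
      (1 / (2 * Real.cosh (t / 2)) * (if n = m then 2 else 0))) (Ioi (2 * a)) :=
    fun n m ↦ ((integrableOn_sech_density_Ioi (2 * a)).mul_const _).const_mul _
  have iA : IntegrableOn (fun t ↦ 1 / (2 * Real.cosh (t / 2)) * weilIncrement (∑ n ∈ s, c n • chi a n) t)
      (Ioc 0 (2 * a)) :=
    IntegrableOn.congr_fun (integrable_finsetSum s fun n _ ↦ integrable_finsetSum s fun m _ ↦ iIoc n m)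
      hIoc.symm measurableSet_Ioc
  have iB : IntegrableOn (fun t ↦ 1 / (2 * Real.cosh (t / 2)) * weilIncrement (∑ n ∈ s, c n • chi a n) t)
      (Ioi (2 * a)) :=
    IntegrableOn.congr_fun (integrable_finsetSum s fun n _ ↦ integrable_finsetSum s fun m _ ↦ iIoi n m)
      hIoi.symm measurableSet_Ioi
  rw [← Ioc_union_Ioi_eq_Ioi hT.le, setIntegral_union Ioc_disjoint_Ioi_same measurableSet_Ioi iA iB,
    setIntegral_congr_fun measurableSet_Ioc hIoc, setIntegral_congr_fun measurableSet_Ioi hIoi,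
    integral_finsetSum _ (fun n _ ↦ integrable_finsetSum s fun m _ ↦ iIoc n m),
    integral_finsetSum _ (fun n _ ↦ integrable_finsetSum s fun m _ ↦ iIoi n m), ← Finset.sum_add_distrib]
  refine Finset.sum_congr rfl fun n _ ↦ ?_
  rw [integral_finsetSum _ (fun m _ ↦ iIoc n m), integral_finsetSum _ (fun m _ ↦ iIoi n m),
    ← Finset.sum_add_distrib]
  refine Finset.sum_congr rfl fun m _ ↦ ?_
  rw [MeasureTheory.integral_const_mul, MeasureTheory.integral_const_mul, ← mul_add]
  congr 1
  unfold sechIncrCoeff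
  by_cases h : n = m
  · subst h
    simp only [if_true]
  · simp only [if_neg h, mul_zero, MeasureTheory.integral_zero, add_zero]
    have hfun : (fun t : ℝ ↦ 1 / (2 * Real.cosh (t / 2)) *
        (-(-1 : ℝ) ^ (n + m) * (Real.sin (π * m / a * t) - Real.sin (π * n / a * t)) / (π * (n - m)))) =
        fun t ↦ (-(-1 : ℝ) ^ (n + m) / (π * (n - m))) *
          (1 / (2 * Real.cosh (t / 2)) * Real.sin (π * m / a * t) -
            1 / (2 * Real.cosh (t / 2)) * Real.sin (π * n / a * t)) := by
      funext t; ring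
    rw [hfun, MeasureTheory.integral_const_mul,
      integral_sub (integrableOn_sech_mul_of_continuous (by fun_prop) a)
        (integrableOn_sech_mul_of_continuous (by fun_prop) a)]

/-! ## Symmetries of the coefficients -/

/-- `sechIncrCoeff a n m = sechIncrCoeff a m n`. -/
theorem sechIncrCoeff_comm (a : ℝ) (n m : ℤ) : sechIncrCoeff a n m = sechIncrCoeff a m n := by
  unfold sechIncrCoeff
  by_cases h : n = m
  · subst h; rfl
  · rw [if_neg h, if_neg (Ne.symm h), show m + n = n + m from add_comm m n,
      show (π * ((m : ℝ) - n)) = -(π * ((n : ℝ) - m)) by ring, div_neg, ← neg_div]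
    ring

/-- `sechIncrCoeff a (−n) (−m) = sechIncrCoeff a n m`. -/
theorem sechIncrCoeff_neg_neg (a : ℝ) (n m : ℤ) : sechIncrCoeff a (-n) (-m) = sechIncrCoeff a n m := by
  unfold sechIncrCoeff
  have hcos : ∀ t : ℝ, Real.cos (π * ((-n : ℤ) : ℝ) / a * t) = Real.cos (π * n / a * t) := fun t ↦ by
    rw [Int.cast_neg, show π * -(n : ℝ) / a * t = -(π * n / a * t) by ring, Real.cos_neg]
  have hI : ∀ k : ℤ, (∫ t in Ioc 0 (2 * a), 1 / (2 * Real.cosh (t / 2)) * Real.sin (π * ((-k : ℤ) : ℝ) / a * t)) =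
      -∫ t in Ioc 0 (2 * a), 1 / (2 * Real.cosh (t / 2)) * Real.sin (π * k / a * t) := by
    intro k
    rw [← integral_neg]
    refine integral_congr_ae (Eventually.of_forall fun t ↦ ?_)
    simp only
    rw [Int.cast_neg, show π * -(k : ℝ) / a * t = -(π * k / a * t) by ring, Real.sin_neg, mul_neg]
  by_cases h : n = m
  · subst h
    simp only [if_true, hcos]
  · have h' : -n ≠ -m := fun e ↦ h (neg_inj.1 e)
    rw [if_neg h', if_neg h, hI m, hI n, neg_one_zpow_neg_add_neg, Int.cast_neg, Int.cast_neg]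
    have hπ : (π * (-(n : ℝ) - -(m : ℝ))) = -(π * ((n : ℝ) - m)) := by ring
    rw [hπ, div_neg]
    ring

/-- `G^χ_odd(n,m) = G^χ_odd(m,n)`. -/
theorem twistedGramCoeffOdd_comm (χ : DirichletCharacter ℂ q) (a : ℝ) (n m : ℤ) :
    twistedGramCoeffOdd χ a n m = twistedGramCoeffOdd χ a m n := by
  unfold twistedGramCoeffOdd
  rw [twistedGramCoeff_comm, sechIncrCoeff_comm]
  by_cases h : n = m
  · subst h; rfl
  · rw [if_neg h, if_neg (Ne.symm h)]

/-- `G^χ_odd(−n,−m) = G^χ_odd(n,m)`. -/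
theorem twistedGramCoeffOdd_neg_neg (χ : DirichletCharacter ℂ q) (a : ℝ) (n m : ℤ) :
    twistedGramCoeffOdd χ a (-n) (-m) = twistedGramCoeffOdd χ a n m := by
  unfold twistedGramCoeffOdd
  rw [twistedGramCoeff_neg_neg, sechIncrCoeff_neg_neg]
  by_cases h : n = m
  · subst h; simp
  · rw [if_neg h, if_neg (fun e ↦ h (neg_inj.1 e))]

/-! ## The entry theorem for an odd real character -/

section Pairing

variable (s : Finset ℤ) (c : ℤ → ℂ)

/-- Linearity of the real pairing: sums. -/
private theorem pair_add'' (G H : ℤ → ℤ → ℝ) :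
    ∑ n ∈ s, ∑ m ∈ s, (conj (c n) * c m).re * (G n m + H n m) =
      (∑ n ∈ s, ∑ m ∈ s, (conj (c n) * c m).re * G n m) +
        ∑ n ∈ s, ∑ m ∈ s, (conj (c n) * c m).re * H n m := by
  simp only [mul_add, Finset.sum_add_distrib]

/-- Linearity of the real pairing: differences. -/
private theorem pair_sub'' (G H : ℤ → ℤ → ℝ) :
    ∑ n ∈ s, ∑ m ∈ s, (conj (c n) * c m).re * (G n m - H n m) =
      (∑ n ∈ s, ∑ m ∈ s, (conj (c n) * c m).re * G n m) -
        ∑ n ∈ s, ∑ m ∈ s, (conj (c n) * c m).re * H n m := by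
  simp only [mul_sub, Finset.sum_sub_distrib]

/-- Linearity of the real pairing: scalars. -/
private theorem pair_const_mul'' (r : ℝ) (G : ℤ → ℤ → ℝ) :
    ∑ n ∈ s, ∑ m ∈ s, (conj (c n) * c m).re * (r * G n m) =
      r * ∑ n ∈ s, ∑ m ∈ s, (conj (c n) * c m).re * G n m := by
  rw [Finset.mul_sum]
  refine Finset.sum_congr rfl fun n _ ↦ ?_
  rw [Finset.mul_sum]
  exact Finset.sum_congr rfl fun m _ ↦ by ring

end Pairing

/-- **ENTRY THEOREM for an odd real character**: for `conj χ = χ`, `a_χ = 1`, `a > 0`,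
`𝓔^χ_a(Σ c_nχ_n) − M^χ_a‖Σ c_nχ_n‖₂² = Σ_n Σ_m Re(conj c_n c_m)·twistedGramCoeffOdd χ a n m`. -/
theorem twistedWindowForm_sum_smul_chi_eq_twistedGramCoeffOdd (χ : DirichletCharacter ℂ q)
    (hχ : ∀ n : ℕ, conj (χ (n : ZMod q)) = χ (n : ZMod q)) (hodd : charParity χ = 1) (ha : 0 < a)
    (s : Finset ℤ) (c : ℤ → ℂ) :
    weilDirichletEnergyChar χ a (∑ n ∈ s, c n • chi a n) -
        weilMarkovConstantChar χ a * ∫ x, ‖(∑ n ∈ s, c n • chi a n) x‖ ^ 2 =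
      ∑ n ∈ s, ∑ m ∈ s, (conj (c n) * c m).re * twistedGramCoeffOdd χ a n m := by
  rw [twistedWindowForm_eq_of_odd_real χ hχ hodd ha.le (measurable_sum_smul_chi _ _)
    (fun x hx ↦ sum_smul_chi_eq_zero _ _ hx) (fun x ↦ norm_sum_smul_chi_le _ _ x)
    (fun x y hx hy ↦ norm_sum_smul_chi_sub_le ha _ _ hx hy),
    core_sum_smul_chi_eq_twistedGramCoeff χ ha s c, setIntegral_sech_mul_weilIncrement_sum_smul_chi ha s c,
    integral_norm_sq_sum_smul_chi' ha]
  have hπ : π * (∑ n ∈ s, ∑ m ∈ s, (conj (c n) * c m).re * (if n = m then (1 : ℝ) else 0)) =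
      ∑ n ∈ s, ∑ m ∈ s, (conj (c n) * c m).re * (if n = m then π else 0) := by
    rw [← pair_const_mul'']
    refine Finset.sum_congr rfl fun n _ ↦ Finset.sum_congr rfl fun m _ ↦ ?_
    split_ifs <;> ring
  rw [hπ]
  simp only [twistedGramCoeffOdd]
  rw [pair_sub'', pair_add'']
  ring

/-! ## The certificate interface for an odd real character -/

/-- **A REAL SECTOR PSD CERTIFICATE of `twistedGramCoeffOdd χ a` gives the rung** (`q ≠ 1`, `a > 0`,
`conj χ = χ`, `a_χ = 1`): per-parity PSD of the even/odd sector matrices of `G^χ_odd` for every `N` ⟹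
`WeilPositivityOnChar χ a`. -/
theorem weilPositivityOnChar_of_twistedGramCoeffOdd_sector_psd (hq : q ≠ 1) (χ : DirichletCharacter ℂ q)
    (hχ : ∀ n : ℕ, conj (χ (n : ZMod q)) = χ (n : ZMod q)) (hodd : charParity χ = 1) (ha : 0 < a)
    (hev : ∀ (N : ℕ) (y : ℕ → ℝ), 0 ≤ ∑ n ∈ Finset.range (N + 1), ∑ m ∈ Finset.range (N + 1),
      y n * y m * (if n = 0 then twistedGramCoeffOdd χ a 0 m else if m = 0 then twistedGramCoeffOdd χ a n 0
        else (twistedGramCoeffOdd χ a n m + twistedGramCoeffOdd χ a n (-(m : ℤ))) / 2))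
    (hod : ∀ (N : ℕ) (z : ℕ → ℝ), 0 ≤ ∑ k ∈ Finset.range N, ∑ l ∈ Finset.range N,
      z k * z l * ((twistedGramCoeffOdd χ a ((k : ℤ) + 1) ((l : ℤ) + 1) -
        twistedGramCoeffOdd χ a ((k : ℤ) + 1) (-((l : ℤ) + 1))) / 2)) :
    WeilPositivityOnChar χ a :=
  weilPositivityOnChar_of_twistedWindowForm_sum_chi_nonneg hq χ ha fun N c ↦ by
    rw [twistedWindowForm_sum_smul_chi_eq_twistedGramCoeffOdd χ hχ hodd ha]
    exact sum_modes_re_conj_mul_nonneg_of_sectors (twistedGramCoeffOdd χ a) (twistedGramCoeffOdd_neg_neg χ a)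
      N (hev N) (hod N) c

open Finset Matrix in
/-- **FORMAT C for an odd real character ⟹ `WeilPositivityOnChar χ a`** — as
`weilPositivityOnChar_of_formatC_certificates` with `G = twistedGramCoeffOdd χ a` (`a_χ = 1`). -/
theorem weilPositivityOnChar_of_formatC_certificates_odd (hq : q ≠ 1) (χ : DirichletCharacter ℂ q)
    (hχ : ∀ n : ℕ, conj (χ (n : ZMod q)) = χ (n : ZMod q)) (hodd : charParity χ = 1) (ha : 0 < a)
    (Be : ℕ) (de : ℕ → ℝ) (Ue : Matrix (Fin Be) (Fin Be) ℝ) (hde : ∀ m, Be ≤ m → 0 < de m)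
    (hfar_e : ∀ (N : ℕ) (y : ℕ → ℝ),
      ∑ n ∈ Ico Be N, de n * y n ^ 2 ≤ ∑ n ∈ Ico Be N, ∑ m ∈ Ico Be N,
        y n * (if n = 0 then twistedGramCoeffOdd χ a 0 m else if m = 0 then twistedGramCoeffOdd χ a n 0
          else (twistedGramCoeffOdd χ a n m + twistedGramCoeffOdd χ a n (-(m : ℤ))) / 2) * y m)
    (hU_e : ∀ (N : ℕ) (x : Fin Be → ℝ),
      ∑ m ∈ Ico Be N, (∑ i : Fin Be,
        (if (i : ℕ) = 0 then twistedGramCoeffOdd χ a 0 m else if m = 0 then twistedGramCoeffOdd χ a i 0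
          else (twistedGramCoeffOdd χ a i m + twistedGramCoeffOdd χ a i (-(m : ℤ))) / 2) * x i) ^ 2 / de m ≤
        x ⬝ᵥ Ue *ᵥ x)
    (hS_e : ∀ x : Fin Be → ℝ, 0 ≤ ∑ i, ∑ j, x i * x j *
      ((if (i : ℕ) = 0 then twistedGramCoeffOdd χ a 0 j else if (j : ℕ) = 0 then twistedGramCoeffOdd χ a i 0
        else (twistedGramCoeffOdd χ a i j + twistedGramCoeffOdd χ a i (-(j : ℤ))) / 2) - Ue i j))
    (Bo : ℕ) (dod : ℕ → ℝ) (Uo : Matrix (Fin Bo) (Fin Bo) ℝ) (hdo : ∀ m, Bo ≤ m → 0 < dod m)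
    (hfar_o : ∀ (N : ℕ) (z : ℕ → ℝ),
      ∑ k ∈ Ico Bo N, dod k * z k ^ 2 ≤ ∑ k ∈ Ico Bo N, ∑ l ∈ Ico Bo N,
        z k * ((twistedGramCoeffOdd χ a ((k : ℤ) + 1) ((l : ℤ) + 1) -
          twistedGramCoeffOdd χ a ((k : ℤ) + 1) (-((l : ℤ) + 1))) / 2) * z l)
    (hU_o : ∀ (N : ℕ) (x : Fin Bo → ℝ),
      ∑ l ∈ Ico Bo N, (∑ i : Fin Bo,
        ((twistedGramCoeffOdd χ a ((i : ℤ) + 1) ((l : ℤ) + 1) -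
          twistedGramCoeffOdd χ a ((i : ℤ) + 1) (-((l : ℤ) + 1))) / 2) * x i) ^ 2 / dod l ≤ x ⬝ᵥ Uo *ᵥ x)
    (hS_o : ∀ x : Fin Bo → ℝ, 0 ≤ ∑ i, ∑ j, x i * x j *
      ((twistedGramCoeffOdd χ a ((i : ℤ) + 1) ((j : ℤ) + 1) -
        twistedGramCoeffOdd χ a ((i : ℤ) + 1) (-((j : ℤ) + 1))) / 2 - Uo i j)) :
    WeilPositivityOnChar χ a := by
  have hsymm := twistedGramCoeffOdd_comm χ a
  have hrefl := twistedGramCoeffOdd_neg_neg χ a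
  refine weilPositivityOnChar_of_twistedGramCoeffOdd_sector_psd hq χ hχ hodd ha (fun N y ↦ ?_) (fun N z ↦ ?_)
  · exact sum_range_mul_mul_nonneg_of_certificate_sum
      (fun n m : ℕ ↦ if n = 0 then twistedGramCoeffOdd χ a 0 m else if m = 0 then twistedGramCoeffOdd χ a n 0
        else (twistedGramCoeffOdd χ a n m + twistedGramCoeffOdd χ a n (-(m : ℤ))) / 2)
      (fun n m ↦ evenKernel_symm _ hsymm hrefl n m) Be de Ue hde hfar_e hU_e hS_e (N + 1) y
  · exact sum_range_mul_mul_nonneg_of_certificate_sum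
      (fun k l : ℕ ↦ (twistedGramCoeffOdd χ a ((k : ℤ) + 1) ((l : ℤ) + 1) -
        twistedGramCoeffOdd χ a ((k : ℤ) + 1) (-((l : ℤ) + 1))) / 2)
      (fun k l ↦ oddKernel_symm _ hsymm hrefl k l) Bo dod Uo hdo hfar_o hU_o hS_o N z

end Summit.Ventures.WeilGRH

end
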